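import Literature.Probability.RandomPlanarGeometry.ArcHullInterior
import Mathlib.Analysis.Calculus.Deriv.MeanValue
import Mathlib.Analysis.Complex.RealDeriv
import HarnessLib

/-!
# Local structure of a regular `C¹` arc, and boundary points of arc hulls

Elementary ingredients for the existence of smooth hit paths
(`IsSmoothHullWith.exists_smoothHitPath`, discharged in `SmoothHitPathExists`):

* `IsArcHull.frontier_subset_closure_interior` — **every boundary point of an arc hull in `ℍ`
  is a limit of interior points**: the boundary arc together with its mirror image is the
  Jordan curve whose inside `U` has `U ∩ ℍ = int A` (as in `ArcHullInterior`), and the frontier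
  of `U` is the whole curve (Jordan curve theorem, `JordanCurveProofs`);
* for a path `γ` with derivative `v = γ'(s₀) ≠ 0` at `s₀` (one-sided within `[0,1]`) and
  continuous `γ'`, in the coordinates `T(z) = re ((z - γ s₀) v̄)`, `N(z) = im ((z - γ s₀) v̄)`
  (tangential and normal components, scaled by `‖v‖`):
  `exists_cone_of_hasDerivWithinAt` — near `s₀`, `|N(γ s)| ≤ |T(γ s)|/2` and
  `|T(γ s)| ≥ (3/4)‖v‖² |s - s₀|`; `exists_strictMonoOn_tangential` — `s ↦ T(γ s)` is strictly
  increasing near `s₀`; `exists_pos_le_norm_sub_of_far` — parameters away from `s₀` give points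
  away from `γ s₀` (injectivity and compactness).

All folklore.
-/

noncomputable section

open Set Filter Metric Complex Function
open _root_.Topology
open UpperHalfPlane (upperHalfPlaneSet isOpen_upperHalfPlaneSet)
open scoped unitInterval ComplexConjugate

namespace Literature.Probability.RandomPlanarGeometry

/-! ### Boundary points of arc hulls are limits of interior points -/

/-- **Boundary points of an arc hull in `ℍ` lie in the closure of its interior.** [folklore] -/
theorem IsArcHull.frontier_subset_closure_interior {J : Set ℂ} (hJ : IsArcHull J) :
    upperHalfPlaneSet ∩ frontier J ⊆ closure (interior J) := by
  obtain ⟨x₀, x₁, P, -, hPi, him, hreal, -, hfr, -, -⟩ :=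
    hJ.sides Literature.Topology.PlaneTopology.JordanCurveTheorem_holds
  obtain ⟨U, V, hUo, hVo, -, -, hUV, hunion, hfU, -, hUb, -⟩ :=
    Literature.Topology.PlaneTopology.JordanCurveTheorem_holds.symmetric P hPi him hreal
  set Λ : Set ℂ := range P ∪ conj '' range P with hΛ
  have hJc : IsClosed J := hJ.1.isClosed
  -- points of `Λ` in `ℍ` are on the arc, at interior parameters, hence on `∂J`
  have hΛfr : ∀ w ∈ Λ, 0 < w.im → w ∈ frontier J := by
    rintro w (⟨s, rfl⟩ | ⟨_, ⟨s, rfl⟩, rfl⟩) hpos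
    · have hs0 : 0 < (s : ℝ) := by
        by_contra h
        have : s = 0 := Subtype.ext (le_antisymm (not_lt.1 h) s.2.1)
        rw [this, P.source, ofReal_im] at hpos
        exact lt_irrefl _ hpos
      have hs1 : (s : ℝ) < 1 := by
        by_contra h
        have : s = 1 := Subtype.ext (le_antisymm s.2.2 (not_lt.1 h))
        rw [this, P.target, ofReal_im] at hpos
        exact lt_irrefl _ hpos
      have : P s ∈ upperHalfPlaneSet ∩ frontier J := by rw [hfr]; exact ⟨s, ⟨hs0, hs1⟩, rfl⟩
      exact this.2
    · exfalso
      rw [conj_im] at hpos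
      linarith [him s]
  -- `ℍ ∖ J ⊆ V`
  have hHJV : upperHalfPlaneSet \ J ⊆ V := by
    have hconn : IsConnected (upperHalfPlaneSet \ J) := hJ.1.2.2.isPathConnected.isConnected
    obtain ⟨R, hR⟩ := hJ.1.1.subset_closedBall 0
    have hunb : ¬ Bornology.IsBounded (upperHalfPlaneSet \ J) := fun hb ↦ by
      obtain ⟨R', hR'⟩ := hb.subset_closedBall 0
      set z : ℂ := ((|R| + |R'| + 1 : ℝ) : ℂ) * Complex.I with hz
      have hzim : z.im = |R| + |R'| + 1 := by simp [hz]
      have hzn : ‖z‖ = |R| + |R'| + 1 := by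
        rw [hz, norm_mul, norm_real, norm_I, mul_one, Real.norm_eq_abs, abs_of_pos (by positivity)]
      have hzmem : z ∈ upperHalfPlaneSet \ J := by
        refine ⟨by show 0 < z.im; rw [hzim]; positivity, fun hzJ ↦ ?_⟩
        have h1 := hR hzJ
        rw [mem_closedBall, dist_zero_right, hzn] at h1
        linarith [le_abs_self R, abs_nonneg R']
      have h2 := hR' hzmem
      rw [mem_closedBall, dist_zero_right, hzn] at h2
      linarith [le_abs_self R', abs_nonneg R]
    have hdisj : upperHalfPlaneSet \ J ⊆ Λᶜ := by
      intro z hz hzΛ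
      exact hz.2 (hJc.frontier_subset (hΛfr z hzΛ hz.1))
    rcases hconn.isPreconnected.subset_or_subset hUo hVo hUV (hunion.symm ▸ hdisj) with h | h
    · exact absurd (hUb.subset h) hunb
    · exact h
  -- `U ∩ ℍ ⊆ interior J`
  have hUint : U ∩ upperHalfPlaneSet ⊆ interior J := by
    rintro u ⟨hu, hpos⟩
    have huΛ : u ∉ Λ := fun h ↦ (show u ∈ Λᶜ by rw [← hunion]; exact Or.inl hu) h
    have huJ : u ∈ J := by
      by_contra h
      exact Set.disjoint_left.1 hUV hu (hHJV ⟨hpos, h⟩)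
    have hufr : u ∉ frontier J := fun h ↦ by
      have : u ∈ upperHalfPlaneSet ∩ frontier J := ⟨hpos, h⟩
      rw [hfr] at this
      obtain ⟨s, -, hs⟩ := this
      exact huΛ (Or.inl ⟨s, hs⟩)
    rw [← self_sdiff_frontier]
    exact ⟨huJ, hufr⟩
  -- a boundary point of `J` in `ℍ` is on `Λ = ∂U`, and nearby points of `U` are in `ℍ`
  rintro z ⟨hzH, hzfr⟩
  have hzΛ : z ∈ Λ := by
    have : z ∈ upperHalfPlaneSet ∩ frontier J := ⟨hzH, hzfr⟩
    rw [hfr] at this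
    obtain ⟨s, -, rfl⟩ := this
    exact Or.inl ⟨s, rfl⟩
  have hzclU : z ∈ closure U := by
    rw [← hfU] at hzΛ
    exact frontier_subset_closure hzΛ
  have hzim : 0 < z.im := hzH
  rw [mem_closure_iff_nhds] at hzclU ⊢
  intro t ht
  obtain ⟨u, ⟨hut, hub⟩, huU⟩ := hzclU (t ∩ ball z z.im) (inter_mem ht (ball_mem_nhds z hzim))
  refine ⟨u, hut, hUint ⟨huU, ?_⟩⟩
  show 0 < u.im
  rw [mem_ball, dist_eq_norm] at hub
  have h1 := Complex.abs_im_le_norm (u - z)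
  rw [Complex.sub_im] at h1
  linarith [(abs_lt.1 (lt_of_le_of_lt h1 hub)).1]

/-! ### Local structure of a regular `C¹` arc at a parameter -/

section LocalArc

variable {γ γ' : ℝ → ℂ} {s₀ : ℝ}

/-- Tangential/normal components: `(z - z₀) v̄` has real part the (scaled) tangential and
imaginary part the (scaled) normal coordinate of `z` at `z₀` with respect to `v`; its norm is
`‖z - z₀‖ ‖v‖`. [folklore] -/
theorem norm_sub_mul_conj (z z₀ v : ℂ) : ‖(z - z₀) * conj v‖ = ‖z - z₀‖ * ‖v‖ := by
  rw [norm_mul, Complex.norm_conj]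

/-- **First-order cone at a regular point**: if `γ` has derivative `v ≠ 0` at `s₀` within
`[0, 1]`, then for `s ∈ [0, 1]` near `s₀` the normal component of `γ s - γ s₀` is at most half
the tangential one, which is at least `(3/4) ‖v‖² |s - s₀|`. [folklore] -/
theorem exists_cone_of_hasDerivWithinAt
    (hγ : HasDerivWithinAt γ (γ' s₀) (Icc 0 1) s₀) (hv : γ' s₀ ≠ 0) :
    ∃ κ > 0, ∀ s ∈ Icc (0 : ℝ) 1, |s - s₀| < κ →
      |((γ s - γ s₀) * conj (γ' s₀)).im| ≤ |((γ s - γ s₀) * conj (γ' s₀)).re| / 2 ∧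
      3 / 4 * ‖γ' s₀‖ ^ 2 * |s - s₀| ≤ |((γ s - γ s₀) * conj (γ' s₀)).re| := by
  set v : ℂ := γ' s₀ with hvdef
  have hvpos : 0 < ‖v‖ := norm_pos_iff.2 hv
  have hlo := (hasDerivWithinAt_iff_isLittleO.1 hγ).def (show (0 : ℝ) < ‖v‖ / 4 by positivity)
  rw [eventually_nhdsWithin_iff, Metric.eventually_nhds_iff] at hlo
  obtain ⟨κ, hκ, hbound⟩ := hlo
  refine ⟨κ, hκ, fun s hs hsκ ↦ ?_⟩
  have hr := hbound (by rwa [Real.dist_eq]) hs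
  set r : ℂ := γ s - γ s₀ - (s - s₀) • v with hrdef
  have hrn : ‖r‖ ≤ ‖v‖ / 4 * |s - s₀| := by rwa [Real.norm_eq_abs] at hr
  have hw : γ s - γ s₀ = ((s - s₀ : ℝ) : ℂ) * v + r := by
    rw [hrdef, Complex.real_smul]; ring
  have hvv : v * conj v = ((‖v‖ ^ 2 : ℝ) : ℂ) := by
    rw [Complex.mul_conj, Complex.normSq_eq_norm_sq]
  have hprod : (γ s - γ s₀) * conj v = (((s - s₀) * ‖v‖ ^ 2 : ℝ) : ℂ) + r * conj v := by
    rw [hw, add_mul, mul_assoc, hvv]; push_cast; ring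
  have hre : ((γ s - γ s₀) * conj v).re = (s - s₀) * ‖v‖ ^ 2 + (r * conj v).re := by
    rw [hprod, Complex.add_re, Complex.ofReal_re]
  have him : ((γ s - γ s₀) * conj v).im = (r * conj v).im := by
    rw [hprod, Complex.add_im, Complex.ofReal_im, zero_add]
  have hrv : ‖r * conj v‖ ≤ ‖v‖ ^ 2 * |s - s₀| / 4 := by
    rw [norm_mul, Complex.norm_conj]
    calc ‖r‖ * ‖v‖ ≤ ‖v‖ / 4 * |s - s₀| * ‖v‖ := by gcongr
      _ = ‖v‖ ^ 2 * |s - s₀| / 4 := by ring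
  have hre_err : |(r * conj v).re| ≤ ‖v‖ ^ 2 * |s - s₀| / 4 := (Complex.abs_re_le_norm _).trans hrv
  have him_err : |(r * conj v).im| ≤ ‖v‖ ^ 2 * |s - s₀| / 4 := (Complex.abs_im_le_norm _).trans hrv
  have hmain : 3 / 4 * ‖v‖ ^ 2 * |s - s₀| ≤ |((γ s - γ s₀) * conj v).re| := by
    rw [hre]
    have h1 : |(s - s₀) * ‖v‖ ^ 2| = ‖v‖ ^ 2 * |s - s₀| := by
      rw [abs_mul, abs_of_nonneg (by positivity : (0 : ℝ) ≤ ‖v‖ ^ 2)]; ring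
    have h2 := abs_sub_abs_le_abs_sub ((s - s₀) * ‖v‖ ^ 2) (-(r * conj v).re)
    rw [abs_neg, sub_neg_eq_add, h1] at h2
    linarith
  refine ⟨?_, hmain⟩
  rw [him]
  have : 0 ≤ ‖v‖ ^ 2 * |s - s₀| := by positivity
  linarith

/-- **The tangential coordinate is strictly increasing along the arc near a regular point**
(continuity of `γ'`: `re (γ'(s) v̄) ≥ ‖v‖²/2 > 0` near `s₀`). [folklore] -/
theorem exists_strictMonoOn_tangential (hs₀ : s₀ ∈ Icc (0 : ℝ) 1)
    (hγ : ∀ t ∈ Icc (0 : ℝ) 1, HasDerivWithinAt γ (γ' t) (Icc 0 1) t)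
    (hγ'c : ContinuousOn γ' (Icc 0 1)) (hv : γ' s₀ ≠ 0) :
    ∃ κ > 0, StrictMonoOn (fun s ↦ ((γ s - γ s₀) * conj (γ' s₀)).re) (Icc 0 1 ∩ Icc (s₀ - κ) (s₀ + κ)) := by
  set v : ℂ := γ' s₀ with hvdef
  have hvpos : 0 < ‖v‖ := norm_pos_iff.2 hv
  -- `‖γ' s - v‖ < ‖v‖/2` near `s₀`
  have hc := hγ'c s₀ hs₀
  rw [Metric.continuousWithinAt_iff] at hc
  obtain ⟨κ₀, hκ₀, hclose⟩ := hc (‖v‖ / 2) (by positivity)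
  refine ⟨κ₀ / 2, by positivity, ?_⟩
  set D : Set ℝ := Icc 0 1 ∩ Icc (s₀ - κ₀ / 2) (s₀ + κ₀ / 2) with hD
  have hDconv : Convex ℝ D := (convex_Icc 0 1).inter (convex_Icc _ _)
  have hDsub : D ⊆ Icc 0 1 := inter_subset_left
  have hγc : ContinuousOn γ (Icc 0 1) := fun t ht ↦ (hγ t ht).continuousWithinAt
  set f : ℝ → ℝ := fun s ↦ ((γ s - γ s₀) * conj v).re with hf
  have hfc : ContinuousOn f D := by
    have h1 : ContinuousOn (fun s ↦ (γ s - γ s₀) * conj v) (Icc 0 1) :=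
      (hγc.sub continuousOn_const).mul continuousOn_const
    exact (Complex.continuous_re.comp_continuousOn h1).mono hDsub
  have hderiv : ∀ x ∈ interior D, HasDerivWithinAt f ((γ' x * conj v).re) (interior D) x := by
    intro x hx
    have hxI : x ∈ Icc (0 : ℝ) 1 := hDsub (interior_subset hx)
    have h1 : HasDerivWithinAt (fun s ↦ (γ s - γ s₀) * conj v) (γ' x * conj v) (interior D) x :=
      (((hγ x hxI).mono (interior_subset.trans hDsub)).sub_const (γ s₀)).mul_const (conj v)
    have h2 := Complex.reCLM.hasFDerivAt.comp_hasDerivWithinAt x h1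
    exact h2
  have hpos : ∀ x ∈ interior D, 0 < (γ' x * conj v).re := by
    intro x hx
    have hxD : x ∈ D := interior_subset hx
    have hxI : x ∈ Icc (0 : ℝ) 1 := hDsub hxD
    have hdist : dist x s₀ < κ₀ := by
      rw [Real.dist_eq]
      have h1 := hxD.2
      rw [mem_Icc] at h1
      rw [abs_lt]; constructor <;> linarith
    have h1 : ‖γ' x - v‖ < ‖v‖ / 2 := by rw [← dist_eq_norm]; exact hclose hxI hdist
    have hvv : (v * conj v).re = ‖v‖ ^ 2 := by
      rw [Complex.mul_conj, Complex.normSq_eq_norm_sq]; norm_cast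
    have h2 : (γ' x * conj v).re = ‖v‖ ^ 2 + ((γ' x - v) * conj v).re := by
      rw [sub_mul, Complex.sub_re, hvv]; ring
    have h3 : |((γ' x - v) * conj v).re| ≤ ‖v‖ / 2 * ‖v‖ := by
      refine (Complex.abs_re_le_norm _).trans ?_
      rw [norm_mul, Complex.norm_conj]
      exact mul_le_mul_of_nonneg_right h1.le (norm_nonneg _)
    rw [h2]
    have h4 := (abs_le.1 h3).1
    nlinarith
  exact strictMonoOn_of_hasDerivWithinAt_pos hDconv hfc hderiv hpos

/-- **Parameters away from `s₀` give points away from `γ s₀`** (injectivity on the compact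
parameter set). [folklore] -/
theorem exists_pos_le_norm_sub_of_far (hγc : ContinuousOn γ (Icc 0 1)) (hinj : InjOn γ (Icc 0 1))
    (hs₀ : s₀ ∈ Icc (0 : ℝ) 1) {κ : ℝ} (hκ : 0 < κ) :
    ∃ d₀ > 0, ∀ s ∈ Icc (0 : ℝ) 1, κ ≤ |s - s₀| → d₀ ≤ ‖γ s - γ s₀‖ := by
  set S : Set ℝ := Icc 0 1 ∩ {s | κ ≤ |s - s₀|} with hS
  have hSc : IsCompact S :=
    isCompact_Icc.inter_right (isClosed_le continuous_const ((continuous_id.sub continuous_const).abs))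
  by_cases hne : S.Nonempty
  · have hcont : ContinuousOn (fun s ↦ ‖γ s - γ s₀‖) S :=
      ((hγc.mono inter_subset_left).sub continuousOn_const).norm
    obtain ⟨s₁, hs₁, hmin⟩ := hSc.exists_isMinOn hne hcont
    have hpos : 0 < ‖γ s₁ - γ s₀‖ := by
      rw [norm_pos_iff, sub_ne_zero]
      intro heq
      have := hinj hs₁.1 hs₀ heq
      have h2 : κ ≤ |s₁ - s₀| := hs₁.2
      rw [this, sub_self, abs_zero] at h2
      linarith
    exact ⟨‖γ s₁ - γ s₀‖, hpos, fun s hs hfar ↦ hmin ⟨hs, hfar⟩⟩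
  · refine ⟨1, one_pos, fun s hs hfar ↦ ?_⟩
    exact absurd ⟨s, hs, hfar⟩ hne

end LocalArc

end Literature.Probability.RandomPlanarGeometry
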